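import Mathlib
import HarnessLib
import Literature.MathematicalPhysics.StatisticalMechanics.LennardJonesClusters

/-!
# ContactSaturationLadder · `LooseTextureRung` (stmt-AtomisticToContinuum-30303) — the uniaxial STRETCH BOUND for a Lennard-Jones pair

Helper module (decomp-a2c lens-1 g26, rung 2 of the strain-mode ladder beneath the coreless law `stub_corelessLaw6`; consumed by
`ContactSaturationLadderDirectionalCharge`).  Pure pair geometry, no ground states, no `e⋆`:

* §1 the uniaxial stretch `S(x) = x + τ⟪u,x⟫u` (`u` a unit vector): `|S(a) − S(b)|² = |a − b|² + (2τ+τ²)·⟪u, b − a⟫²`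
  (`dist_stretch_sq`), injectivity for `1 + τ ≠ 0` (`stretch_injective`), `(⟪u, b − a⟫/|a − b|)² ≤ 1` (`dirCos_sq_le_one`);
* §2 second-order control without calculus: `1 − 3x ≤ (1+x)⁻³` for `x > −1` (convexity) and `(1+x)⁻⁶ ≤ 1 − 6x + 49x²` for
  `|x| ≤ 1/10` (explicit polynomial certificate);
* §3 the PAIR BOUND `lennardJones_stretch_le`: for `a ≠ b`, `σ = 2τ + τ²`, `|σ| ≤ 1/10`, `r = |a − b|`, `cos² = (⟪u, b − a⟫/r)²`,
      `V_LJ(|S(a) − S(b)|) ≤ V_LJ(r) + σ·½·cos²·(r⁻⁶ − r⁻¹²) + (49/12)·σ²·cos²·r⁻¹²`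
  (`V_LJ(r) = (1/12)r⁻¹² − (1/6)r⁻⁶` as a function of `r²`, expanded to second order in the stretched variable `r²(1 + σcos²)`).
-/

namespace Summit.AtomisticToContinuum.Crystallization.Theorems.ContactSaturationLadderStretchBound

open scoped BigOperators Classical
open Literature.MathematicalPhysics.StatisticalMechanics (lennardJones)

/-! ## §1 The uniaxial stretch `x ↦ x + τ⟪u,x⟫u` of a configuration -/

/-- Differences under the stretch: `S(a) − S(b) = (a − b) + τ⟪u, a − b⟫u`. -/
theorem stretch_sub (u : EuclideanSpace ℝ (Fin 3)) (τ : ℝ) (a b : EuclideanSpace ℝ (Fin 3)) :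
    (a + (τ * inner ℝ u a) • u) - (b + (τ * inner ℝ u b) • u) = (a - b) + (τ * inner ℝ u (a - b)) • u := by
  rw [inner_sub_right, mul_sub, sub_smul]
  abel

/-- **Squared distances under the stretch**: for a unit vector `u`,
`|S(a) − S(b)|² = |a − b|² + (2τ + τ²)·⟪u, b − a⟫²`. -/
theorem dist_stretch_sq {u : EuclideanSpace ℝ (Fin 3)} (hu : ‖u‖ = 1) (τ : ℝ) (a b : EuclideanSpace ℝ (Fin 3)) :
    dist (a + (τ * inner ℝ u a) • u) (b + (τ * inner ℝ u b) • u) ^ 2 =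
      dist a b ^ 2 + (2 * τ + τ ^ 2) * (inner ℝ u (b - a)) ^ 2 := by
  rw [dist_eq_norm, dist_eq_norm, stretch_sub, norm_add_sq_real, inner_smul_right, norm_smul, hu, mul_one,
    Real.norm_eq_abs, sq_abs, real_inner_comm u (a - b)]
  have h : inner ℝ u (b - a) = -inner ℝ u (a - b) := by rw [← neg_sub, inner_neg_right]
  rw [h]
  ring

/-- The stretch with `1 + τ ≠ 0` maps distinct points to distinct points. -/
theorem stretch_injective {N : ℕ} {u : EuclideanSpace ℝ (Fin 3)} (hu : ‖u‖ = 1) {τ : ℝ} (hτ : 1 + τ ≠ 0)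
    {y : Fin N → EuclideanSpace ℝ (Fin 3)} (hy : Function.Injective y) :
    Function.Injective fun i => y i + (τ * inner ℝ u (y i)) • u := by
  intro i j hij
  apply hy
  have h0 : (y i + (τ * inner ℝ u (y i)) • u) - (y j + (τ * inner ℝ u (y j)) • u) = 0 := sub_eq_zero.2 hij
  rw [stretch_sub] at h0
  have h1 : inner ℝ u ((y i - y j) + (τ * inner ℝ u (y i - y j)) • u) = 0 := by rw [h0, inner_zero_right]
  rw [inner_add_right, inner_smul_right, real_inner_self_eq_norm_sq, hu, one_pow, mul_one] at h1
  have h2 : (1 + τ) * inner ℝ u (y i - y j) = 0 := by linarith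
  have h3 : inner ℝ u (y i - y j) = 0 := (mul_eq_zero.1 h2).resolve_left hτ
  rw [h3, mul_zero, zero_smul, add_zero] at h0
  exact sub_eq_zero.1 h0

/-- The squared direction cosine `(⟪u, b − a⟫/|a − b|)² ≤ 1` for a unit vector `u` (Cauchy–Schwarz; `= 0` for `a = b`). -/
theorem dirCos_sq_le_one {u : EuclideanSpace ℝ (Fin 3)} (hu : ‖u‖ = 1) (a b : EuclideanSpace ℝ (Fin 3)) :
    (inner ℝ u (b - a) / dist a b) ^ 2 ≤ 1 := by
  by_cases hab : a = b
  · subst hab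
    simp
  have hr0 : 0 < dist a b := dist_pos.2 hab
  have h1 : |inner ℝ u (b - a)| ≤ dist a b := by
    calc |inner ℝ u (b - a)| ≤ ‖u‖ * ‖b - a‖ := abs_real_inner_le_norm u (b - a)
      _ = dist a b := by rw [hu, one_mul, dist_comm, dist_eq_norm]
  have h2 : |inner ℝ u (b - a) / dist a b| ≤ 1 := by
    rw [abs_div, abs_of_pos hr0, div_le_one hr0]
    exact h1
  have h3 : (inner ℝ u (b - a) / dist a b) ^ 2 ≤ 1 ^ 2 := by
    rw [← sq_abs]
    exact pow_le_pow_left₀ (abs_nonneg _) h2 2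
  simpa using h3

/-! ## §2 One-variable Taylor bounds for `(1+x)⁻³` and `(1+x)⁻⁶` -/

/-- Convexity of `(1+x)⁻³`: `1 − 3x ≤ (1+x)⁻³` for `x > −1`. -/
theorem one_sub_three_mul_le {x : ℝ} (hx : -1 < x) : 1 - 3 * x ≤ ((1 + x)⁻¹) ^ 3 := by
  have h1 : 0 < 1 + x := by linarith
  rw [inv_pow, ← one_div, le_div_iff₀ (pow_pos h1 3)]
  have key : 1 - (1 - 3 * x) * (1 + x) ^ 3 = x ^ 2 * (3 * (x + 4 / 3) ^ 2 + 2 / 3) := by ring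
  nlinarith [key, mul_nonneg (sq_nonneg x) (by positivity : (0 : ℝ) ≤ 3 * (x + 4 / 3) ^ 2 + 2 / 3)]

/-- Second-order bound for `(1+x)⁻⁶` on `|x| ≤ 1/10`: `(1+x)⁻⁶ ≤ 1 − 6x + 49x²`
(`(1 − 6x + 49x²)(1+x)⁶ − 1 = x²·(28 + 224x + 630x² + 896x³ + 700x⁴ + 288x⁵ + 49x⁶) ≥ 0` there). -/
theorem inv_pow_six_le {x : ℝ} (hx : |x| ≤ 1 / 10) : ((1 + x)⁻¹) ^ 6 ≤ 1 - 6 * x + 49 * x ^ 2 := by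
  obtain ⟨hx1, hx2⟩ := abs_le.1 hx
  have h1 : 0 < 1 + x := by linarith
  rw [inv_pow, ← one_div, div_le_iff₀ (pow_pos h1 6)]
  have key : (1 - 6 * x + 49 * x ^ 2) * (1 + x) ^ 6 - 1 =
      x ^ 2 * (28 + 224 * x + x ^ 2 * (630 + 896 * x + 700 * x ^ 2 + 288 * x ^ 3 + 49 * x ^ 4)) := by ring
  have hb : 0 ≤ 630 + 896 * x + 700 * x ^ 2 + 288 * x ^ 3 + 49 * x ^ 4 := by
    have hx3 : -(x ^ 2 / 10) ≤ x ^ 3 := by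
      have := mul_nonneg (by linarith : 0 ≤ x + 1 / 10) (sq_nonneg x)
      nlinarith
    nlinarith [sq_nonneg x, sq_nonneg (x ^ 2)]
  have hg : 0 ≤ 28 + 224 * x + x ^ 2 * (630 + 896 * x + 700 * x ^ 2 + 288 * x ^ 3 + 49 * x ^ 4) := by
    have := mul_nonneg (sq_nonneg x) hb
    linarith
  nlinarith [key, mul_nonneg (sq_nonneg x) hg]

/-! ## §3 The pair bound under the stretch -/

/-- `V_LJ` as a function of the squared distance: `V_LJ(r) = (1/12)(r²)⁻⁶ − (1/6)(r²)⁻³`. -/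
theorem lennardJones_eq_sq (r : ℝ) : lennardJones r = (1 / 12) * ((r ^ 2)⁻¹) ^ 6 - (1 / 6) * ((r ^ 2)⁻¹) ^ 3 := by
  simp only [lennardJones, inv_pow, ← pow_mul]

/-- Second-order expansion in the squared-distance variable: for `Q > 0` and `|x| ≤ 1/10`,
`(1/12)(Q(1+x))⁻⁶ − (1/6)(Q(1+x))⁻³ ≤ (1/12)Q⁻⁶(1 − 6x + 49x²) − (1/6)Q⁻³(1 − 3x)`. -/
theorem pair_sq_bound {Q x : ℝ} (hQ : 0 < Q) (hx : |x| ≤ 1 / 10) :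
    (1 / 12) * ((Q * (1 + x))⁻¹) ^ 6 - (1 / 6) * ((Q * (1 + x))⁻¹) ^ 3 ≤
      (1 / 12) * (Q⁻¹) ^ 6 * (1 - 6 * x + 49 * x ^ 2) - (1 / 6) * (Q⁻¹) ^ 3 * (1 - 3 * x) := by
  obtain ⟨hx1, hx2⟩ := abs_le.1 hx
  have hQ6 : 0 ≤ (1 / 12) * (Q⁻¹) ^ 6 := by positivity
  have hQ3 : 0 ≤ (1 / 6) * (Q⁻¹) ^ 3 := by positivity
  rw [mul_inv, mul_pow, mul_pow]
  have h6 := mul_le_mul_of_nonneg_left (inv_pow_six_le hx) hQ6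
  have h3 := mul_le_mul_of_nonneg_left (one_sub_three_mul_le (by linarith : -1 < x)) hQ3
  linarith

/-- **The pair bound.**  For distinct points `a ≠ b`, a unit vector `u` and `σ = 2τ + τ²` with `|σ| ≤ 1/10`, writing
`r = |a − b|`, `c² = (⟪u, b − a⟫/r)²`:
`V_LJ(|S(a) − S(b)|) ≤ V_LJ(r) + σ·½·c²·(r⁻⁶ − r⁻¹²) + (49/12)·σ²·c²·r⁻¹²`. -/
theorem lennardJones_stretch_le {u : EuclideanSpace ℝ (Fin 3)} (hu : ‖u‖ = 1) {τ : ℝ} (hσ : |2 * τ + τ ^ 2| ≤ 1 / 10)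
    {a b : EuclideanSpace ℝ (Fin 3)} (hab : a ≠ b) :
    lennardJones (dist (a + (τ * inner ℝ u a) • u) (b + (τ * inner ℝ u b) • u)) ≤
      lennardJones (dist a b) +
        (2 * τ + τ ^ 2) * ((1 / 2) * (inner ℝ u (b - a) / dist a b) ^ 2 * ((dist a b)⁻¹ ^ 6 - (dist a b)⁻¹ ^ 12)) +
        (49 / 12) * (2 * τ + τ ^ 2) ^ 2 * ((inner ℝ u (b - a) / dist a b) ^ 2 * (dist a b)⁻¹ ^ 12) := by
  set σ : ℝ := 2 * τ + τ ^ 2 with hσdef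
  set r : ℝ := dist a b with hr
  set c2 : ℝ := (inner ℝ u (b - a) / r) ^ 2 with hc2
  have hr0 : 0 < r := dist_pos.2 hab
  have hQ : 0 < r ^ 2 := by positivity
  -- `0 ≤ c² ≤ 1` (Cauchy–Schwarz)
  have hc20 : 0 ≤ c2 := sq_nonneg _
  have hc21 : c2 ≤ 1 := by rw [hc2, hr]; exact dirCos_sq_le_one hu a b
  -- the stretched squared distance is `r²(1 + σc²)`
  have hx : |σ * c2| ≤ 1 / 10 := by
    rw [abs_mul, abs_of_nonneg hc20]
    calc |σ| * c2 ≤ 1 / 10 * 1 := mul_le_mul hσ hc21 hc20 (by norm_num)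
      _ = 1 / 10 := by ring
  have hd2 : dist (a + (τ * inner ℝ u a) • u) (b + (τ * inner ℝ u b) • u) ^ 2 = r ^ 2 * (1 + σ * c2) := by
    rw [dist_stretch_sq hu, hc2, div_pow, ← hr, hσdef]
    field_simp
  -- expand both sides in the squared-distance variable
  rw [lennardJones_eq_sq, hd2, lennardJones_eq_sq r]
  have hp := pair_sq_bound hQ hx
  have h12 : ((r ^ 2)⁻¹) ^ 6 = r⁻¹ ^ 12 := by rw [inv_pow, inv_pow, ← pow_mul]
  have h6 : ((r ^ 2)⁻¹) ^ 3 = r⁻¹ ^ 6 := by rw [inv_pow, inv_pow, ← pow_mul]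
  rw [h12, h6] at hp ⊢
  have hlast : (49 / 12) * σ ^ 2 * (c2 ^ 2 * r⁻¹ ^ 12) ≤ (49 / 12) * σ ^ 2 * (c2 * r⁻¹ ^ 12) := by
    refine mul_le_mul_of_nonneg_left (mul_le_mul_of_nonneg_right ?_ (by positivity)) (by positivity)
    nlinarith
  nlinarith [hp, hlast]

end Summit.AtomisticToContinuum.Crystallization.Theorems.ContactSaturationLadderStretchBound
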